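import Literature.Probability.Percolation.KestenScalingFromSeparation
import HarnessLib

/-!
# The radius decay beyond `L_ε(p)` at every `ε` from near-critical four-arm separation (assembly, proofs only)

Topic `Literature/Probability/Percolation`; family `crit-perc`. PROOFS ONLY (no definition, no
named fact): the state of the discharge of the named facts `Nolin2008_radius_decay`
(`NearCriticalCorrelationLength.lean`; together with its restriction to `p > 1/2`, the display
`Nolin2008_radius_decay_supercritical_at ε` at every `ε ∈ (0, 1/2)`, formerly a named fact of its
own and merged back into the parent at the review of the decomposition, 2026-08-15) and
`Nolin2008_lemma39` (`NearCriticalArm.lean`) —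
P. Nolin, *Near-critical percolation in two dimensions*, Electron. J. Probab. 13 (2008), §7.5,
proof of Lemma 44 [arXiv 0711.4948: Lemma 42], the two annulus displays
`P_p(∂S_L ↝ ∂S_{kL}) ≤ C₃ e^{-C₄ k}` (`p < 1/2`) and
`P_p(∂S_L ↝ ∂S_{kL}, |C(0)| < ∞) ≤ C₅ e^{-C₆ k}` (`p > 1/2`), `L = L_ε(p)`, "deduced from the
sub-critical case" §7.4, Lemma 39 [arXiv: Lemma 37], which Nolin proves directly for `ε` below
an RSW threshold `ε₀` and extends to every `ε ∈ (0, 1/2)` by the equivalence of lengths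
`L_ε ≍ L_{ε'}` (Cor. 37 [arXiv: Cor. 35]), itself resting on Kesten's scaling relation
(Prop. 34 [arXiv: Prop. 32]) and the four-arm estimates below `L(p)`.

State of the tree. The small-`ε` part is proved unconditionally
(`Nolin2008_radius_decay_supercritical_at_holds_small`, `Nolin2008_radius_decay_at_holds_small`,
`NearCriticalCorrelationLengthProofs.lean`; `Nolin2008_lemma39_at_holds_small`,
`NearCriticalRSWStart.lean`), and the all-`ε` statements are reduced to Kesten's relation and the
two four-arm estimates (`Nolin2008_lemma39_of_scaling`, `Nolin2008_radius_decay_supercritical_of_scaling`,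
`Nolin2008_radius_decay_of_scaling`, loc. cit.). Of those three inputs,
`Werner2009_fourArm_lowerBound` is a theorem (`Werner2009_fourArm_lowerBound_holds`,
`FiveArmLowerBound.lean`), and the other two, `Nolin2008_prop34` and
`Werner2009_fourArm_quasiMult`, are theorems CONDITIONAL ON ONE INPUT
(`Nolin2008_prop34_of_separation`, `KestenScalingFromSeparation.lean`;
`Werner2009_fourArm_quasiMult_of_separation`, `NearCriticalFourArmQuasiMult.lean`): the
comparability, uniformly below Werner's length `L(t, ε) = charLengthW ε t`, of the well-separated
four-arm event with alternating colours `sepFourArm n N` (`ArmSeparationFourArm.lean`) with the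
four-arm event, `c · π̂_t(n, N) ≤ P_t(sepFourArm n N)` for `n₀ ≤ n`, `2n ≤ N`, `N ≤ L(t, ε)` if
`t > 1/2`, `t ∈ [1/2, 1/2 + δ)` — Nolin's arm-separation Thm. 11 [arXiv Thm. 10] for `j = 4`
below `L(p)` (after Kesten 1987, Lemmas 4–6). Hence (this file):

* `Nolin2008_lemma39_of_separation` — Lemma 39 at every `ε ∈ (0, 1/2)`;
* `Nolin2008_radius_decay_supercritical_of_separation` — the `p > 1/2` annulus display at every `ε`;
* `Nolin2008_radius_decay_of_separation` — both displays at every `ε`;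

each from that single separation hypothesis, stated explicitly (the same hypothesis, verbatim, as
in `KestenScalingFromSeparation.lean`, so that one separation theorem discharges Kesten's relation,
`θ ≍ π₁(L)`, the radius decay and everything downstream). The discharges
`Nolin2008_radius_decay_holds`, `Nolin2008_lemma39_holds` are these theorems applied to the
near-critical four-arm separation
theorem once the arm-separation programme (`ArmSeparation*.lean`) reaches `j = 4` below `L(p)`
(for the `p > 1/2` display at every `ε`: `Nolin2008_radius_decay_supercritical_at_of_radius_decay_at`
applied to `Nolin2008_radius_decay_holds`, or directly `…_supercritical_of_separation`); no other
input is missing.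

## References

* P. Nolin, Near-critical percolation in two dimensions, *Electron. J. Probab.* 13 (2008), §7.5
  proof of Lemma 44, §7.4 Lemma 39 and Remark 40, §7.3 Prop. 34 and Cor. 37; Thm. 11, Prop. 12,
  Prop. 17 (arXiv 0711.4948: Lemma 42, Lemma 37, Remark 38, Prop. 32, Cor. 35; Thm. 10, Prop. 11,
  Prop. 16) [Nolin2008].
* H. Kesten, Scaling relations for 2D-percolation, *Comm. Math. Phys.* 109 (1987), (4.5),
  Lemmas 4–6 [KestenScalingCMP1987].
* W. Werner, *Lectures on two-dimensional critical percolation*, IAS/Park City Math. Ser. 16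
  (2009), Lecture 6, §3, Prop. 6.1, Cor. 6.2 [WernerPCMI2009].

Tree: `Nolin2008_lemma39_of_scaling`, `Nolin2008_radius_decay_supercritical_of_scaling`,
`Nolin2008_radius_decay_of_scaling` (`NearCriticalCorrelationLengthProofs.lean`),
`Nolin2008_prop34_of_separation` (`KestenScalingFromSeparation.lean`),
`Werner2009_fourArm_quasiMult_of_separation` (`NearCriticalFourArmQuasiMult.lean`),
`Werner2009_fourArm_lowerBound_holds` (`FiveArmLowerBound.lean`).
Mathlib search: nothing percolation-specific in Mathlib; pure assembly.
-/

noncomputable section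

namespace Literature.Probability.Percolation

/-- **Lemma 39 at every `ε ∈ (0, 1/2)` (`Nolin2008_lemma39`) from near-critical four-arm
separation** (Nolin 2008, §7.4, Lemma 39 [arXiv 0711.4948: Lemma 37], last paragraph of its
proof: "The result for any `ε ∈ (0, 1/2)` follows readily by using the equivalence of lengths
for different values of `ε` (Corollary 37)"): `Nolin2008_lemma39_of_scaling` with Kesten's
relation `Nolin2008_prop34_of_separation hsep`, the quasi-multiplicativity
`Werner2009_fourArm_quasiMult_of_separation hsep` and the theorem
`Werner2009_fourArm_lowerBound_holds`. IF `c · π̂_t(n, N) ≤ P_t(sepFourArm n N)` uniformly for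
`n₀ ≤ n`, `2n ≤ N ≤ L(t, ε)`, `t ∈ [1/2, 1/2 + δ)` (Nolin's Thm. 11 [arXiv Thm. 10], `j = 4`,
below `L(p)`), THEN Lemma 39 holds at every `ε`; the discharge `Nolin2008_lemma39_holds` is this
theorem applied to that separation theorem once it lands. [cite: Nolin2008, §7.4 Lemma 39 with §7.3 Prop. 34 and Cor. 37, Thm. 11 (arXiv 0711.4948: Lemma 37, Prop. 32, Cor. 35, Thm. 10)] [cite: WernerPCMI2009, Lecture 6, §3 and Cor. 6.2] -/
theorem Nolin2008_lemma39_of_separation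
    (hsep : ∃ ε₁ > (0 : ℝ), ∀ ⦃ε : ℝ⦄, 0 < ε → ε < ε₁ →
      ∃ n₀ : ℕ, ∃ δ > (0 : ℝ), ∃ c > (0 : ℝ),
        ∀ t : unitInterval, 1 / 2 ≤ (t : ℝ) → (t : ℝ) < 1 / 2 + δ →
          ∀ n N : ℕ, n₀ ≤ n → 2 * n ≤ N → (1 / 2 < (t : ℝ) → N ≤ charLengthW ε t) →
            c * fourArmProbAt t n N ≤ (LatticeModels.triSitePercolation t).real (sepFourArm n N)) :
    Nolin2008_lemma39 :=
  Nolin2008_lemma39_of_scaling (Nolin2008_prop34_of_separation hsep)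
    (Werner2009_fourArm_quasiMult_of_separation hsep) Werner2009_fourArm_lowerBound_holds

/-- **The `p > 1/2` annulus display at every `ε ∈ (0, 1/2)`
(`Nolin2008_radius_decay_supercritical_at ε`: `P_p(0 ↝ ∂S_{k L_ε(p)}, |C(0)| < ∞) ≤ C e^{-c k}`
uniformly for `p > 1/2` near `1/2`) from near-critical four-arm separation** (Nolin 2008, §7.5,
proof of Lemma 44 [arXiv 0711.4948: Lemma 42], second annulus display, "deduced from the
sub-critical case" Lemma 39): `Nolin2008_radius_decay_supercritical_of_scaling` with
`Nolin2008_prop34_of_separation hsep`, `Werner2009_fourArm_quasiMult_of_separation hsep` and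
`Werner2009_fourArm_lowerBound_holds`. The small-`ε` part holds unconditionally
(`Nolin2008_radius_decay_supercritical_at_holds_small`); the separation hypothesis (Nolin's
Thm. 11 [arXiv Thm. 10] for `j = 4` below `L(p)`) is the only input missing for every `ε`; the
restriction to `p > 1/2` of `Nolin2008_radius_decay_of_separation` (the all-`ε` display is no
longer a named fact of its own: merged into `Nolin2008_radius_decay`, review of the decomposition,
2026-08-15). [cite: Nolin2008, §7.5, proof of Lemma 44 (arXiv 0711.4948: Lemma 42), second annulus display; §7.4 Lemma 39, §7.3 Prop. 34 and Cor. 37, Thm. 11 (arXiv: Lemma 37, Prop. 32, Cor. 35, Thm. 10)] [cite: WernerPCMI2009, Lecture 6, §3 and Cor. 6.2] -/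
theorem Nolin2008_radius_decay_supercritical_of_separation
    (hsep : ∃ ε₁ > (0 : ℝ), ∀ ⦃ε : ℝ⦄, 0 < ε → ε < ε₁ →
      ∃ n₀ : ℕ, ∃ δ > (0 : ℝ), ∃ c > (0 : ℝ),
        ∀ t : unitInterval, 1 / 2 ≤ (t : ℝ) → (t : ℝ) < 1 / 2 + δ →
          ∀ n N : ℕ, n₀ ≤ n → 2 * n ≤ N → (1 / 2 < (t : ℝ) → N ≤ charLengthW ε t) →
            c * fourArmProbAt t n N ≤ (LatticeModels.triSitePercolation t).real (sepFourArm n N)) :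
    ∀ ε : ℝ, 0 < ε → ε < 1 / 2 → Nolin2008_radius_decay_supercritical_at ε :=
  Nolin2008_radius_decay_supercritical_of_scaling (Nolin2008_prop34_of_separation hsep)
    (Werner2009_fourArm_quasiMult_of_separation hsep) Werner2009_fourArm_lowerBound_holds

/-- **Both annulus displays at every `ε ∈ (0, 1/2)` (`Nolin2008_radius_decay`) from near-critical
four-arm separation** (Nolin 2008, §7.5, proof of Lemma 44 [arXiv 0711.4948: Lemma 42]):
`Nolin2008_radius_decay_of_scaling` with `Nolin2008_prop34_of_separation hsep`,
`Werner2009_fourArm_quasiMult_of_separation hsep` and `Werner2009_fourArm_lowerBound_holds`;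
cf. `Nolin2008_radius_decay_of_facts4` (`NearCriticalRadiusDecayFromFourFacts.lean`) for the
four-fact form. The discharge `Nolin2008_radius_decay_holds` is this theorem applied to the
near-critical four-arm separation theorem once it lands. [cite: Nolin2008, §7.5, proof of Lemma 44 (arXiv 0711.4948: Lemma 42), both annulus displays; §7.4 Lemma 39, §7.3 Prop. 34 and Cor. 37, Thm. 11 (arXiv: Lemma 37, Prop. 32, Cor. 35, Thm. 10)] [cite: WernerPCMI2009, Lecture 6, §3 and Cor. 6.2] -/
theorem Nolin2008_radius_decay_of_separation
    (hsep : ∃ ε₁ > (0 : ℝ), ∀ ⦃ε : ℝ⦄, 0 < ε → ε < ε₁ →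
      ∃ n₀ : ℕ, ∃ δ > (0 : ℝ), ∃ c > (0 : ℝ),
        ∀ t : unitInterval, 1 / 2 ≤ (t : ℝ) → (t : ℝ) < 1 / 2 + δ →
          ∀ n N : ℕ, n₀ ≤ n → 2 * n ≤ N → (1 / 2 < (t : ℝ) → N ≤ charLengthW ε t) →
            c * fourArmProbAt t n N ≤ (LatticeModels.triSitePercolation t).real (sepFourArm n N)) :
    Nolin2008_radius_decay :=
  Nolin2008_radius_decay_of_scaling (Nolin2008_prop34_of_separation hsep)
    (Werner2009_fourArm_quasiMult_of_separation hsep) Werner2009_fourArm_lowerBound_holds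

end Literature.Probability.Percolation
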